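import Mathlib
import Summits.KontsevichZagierPeriods.KontsevichZagierPeriods.Theses.InverseLandau
import Literature.NumberTheory.Transcendental.KZLogCalculusProofs
import Literature.NumberTheory.Transcendental.KZProductIdeal
import Summits.KontsevichZagierPeriods.KontsevichZagierPeriods.Theorems.CompiledSubstitutionsPiNormalisation
import Summits.KontsevichZagierPeriods.KontsevichZagierPeriods.Theorems.CobordismMoveCP2VolumeCharts

/-!
# `TateLifting` (stmt-KontsevichZagierPeriods-9129), line `Sketch` — the tube is the twist

Stub `stub_tubeIsTwist` of the crux `TateLifting` (kernel form of the Kontsevich–Zagier period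
conjecture), verbatim the item `TubeIsTwist` (stmt-KontsevichZagierPeriods-14422) of route
AttractorUnfolding: *multiplying a representation `ρ = [σ, f]` by `π` written as `∫_ℝ dt/(1+t²)` (a new
LAST coordinate) or as the closed unit disc (two new LEADING coordinates) gives the same formal period*,
i.e. `[σ × ℝ, f(x)/(1+t²)] − [D̄ × σ, f] ∈ KZ.relations`, uniformly in `ρ` and for ANY operation `P`
pinned by the two literal field equations of "disc × ρ".

Proof (`tateLifting_tubeIsTwist`), entirely inside the formal period ring of
`Literature/NumberTheory/Transcendental/KZProduct.lean` / `KZProductIdeal.lean`: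
* `[σ × ℝ, f/(1+t²)]` has the same domain and the same integrand on it as the product representation
  `ρ.prod L`, `L = [ℝ, 1/(1+y²)]` (`exists_cauchyRep₁`), hence differs from it by relations
  (`KZ.of_sub_of_mem_relations_of_eqOn`);
* `L ∼ [disc]` is the tree's `PiNormalisation` (route CompiledSubstitutions, `piNormalisation_proof`),
  and products respect equivalence (`KZ.Equivalent.prod`): `ρ.prod L ∼ ρ.prod piRep`;
* the product is commutative modulo relations (`KZ.of_mul_of_sub_of_mul_of_mem_relations`):
  `ρ.prod piRep ∼ piRep.prod ρ`;
* `piRep.prod ρ : IntegralRep (2 + n)` relabelled along `finCongr (Nat.add_comm 2 n)` is a move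
  (`KZ.of_sub_of_reindex_mem_relations`), and the relabelled record has the same domain and integrand as
  `P n ρ` (three `Fin` index identities), hence differs from it by relations.

References: M. Kontsevich, D. Zagier, *Periods* (2001), §1.1 eq. (1), §1.2, §4.1.
-/

noncomputable section

open MeasureTheory Set
open Literature.NumberTheory.Transcendental

namespace Summit.KontsevichZagierPeriods.InverseLandau

namespace TubeIsTwist

variable {n : ℕ}

/-- The cast `Fin (2 + n) ≃ Fin (n + 2)` sends the leading coordinate `castAdd n 0` to `0`. [folklore] -/
theorem finCongr_castAdd_zero :
    finCongr (Nat.add_comm 2 n) (Fin.castAdd n (0 : Fin 2)) = (0 : Fin (n + 2)) := by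
  ext; simp

/-- The cast `Fin (2 + n) ≃ Fin (n + 2)` sends the coordinate `castAdd n 1` to `1`. [folklore] -/
theorem finCongr_castAdd_one :
    finCongr (Nat.add_comm 2 n) (Fin.castAdd n (1 : Fin 2)) = (1 : Fin (n + 2)) := by
  ext; simp

/-- The cast `Fin (2 + n) ≃ Fin (n + 2)` sends the trailing coordinate `natAdd 2 j` to `j + 2`.
[folklore] -/
theorem finCongr_natAdd (j : Fin n) :
    finCongr (Nat.add_comm 2 n) (Fin.natAdd 2 j) = j.succ.succ :=
  Fin.ext (by simp only [finCongr_apply, Fin.val_cast, Fin.val_natAdd, Fin.val_succ]; omega)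

/-- The unique trailing coordinate of `Fin (n + 1)` in block form is the last one. [folklore] -/
theorem natAdd_zero_eq_last : Fin.natAdd n (0 : Fin 1) = Fin.last n := by
  ext; simp

/-- **`[ℝ, 1/(1+y²)] ∼ [disc]`** — the tree's `PiNormalisation` (route CompiledSubstitutions, proved),
specialised to the pinned disc `KZ.piRep`. [cite: KontsevichZagier2001, §1.1 eq. (1)] -/
theorem cauchy_equivalent_piRep (L : KZ.IntegralRep 1) (hLd : L.domain = univ)
    (hLi : L.integrand = fun y => 1 / (1 + y 0 ^ 2)) : KZ.Equivalent L KZ.piRep :=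
  (Summit.KontsevichZagierPeriods.CompiledSubstitutions.PiNormalisation.piNormalisation_proof KZ.piRep
    rfl (fun _ _ => rfl)).1 L hLd (fun x _ => by rw [hLi])

/-- **The tube is a product**: a representation with domain `{z | init z ∈ σ}` and integrand
`f(init z)/(1 + z_last²)` on it differs by relations from `ρ.prod L`, `L = [ℝ, 1/(1+y²)]` (same domain,
same integrand on it: rule (1)). [cite: KontsevichZagier2001, §1.2] -/
theorem tube_equivalent_prod (ρ : KZ.IntegralRep n) (r' : KZ.IntegralRep (n + 1))
    (hd : r'.domain = {z | (Fin.init z : Fin n → ℝ) ∈ ρ.domain})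
    (hi : EqOn r'.integrand (fun z => ρ.integrand (Fin.init z) / (1 + z (Fin.last n) ^ 2)) r'.domain)
    (L : KZ.IntegralRep 1) (hLd : L.domain = univ) (hLi : L.integrand = fun y => 1 / (1 + y 0 ^ 2)) :
    KZ.Equivalent r' (ρ.prod L) := by
  refine KZ.of_sub_of_mem_relations_of_eqOn ?_ fun z hz => ?_
  · rw [hd, KZ.IntegralRep.prod_domain]
    ext z
    simp only [KZ.IntegralRep.mem_prodDomain, hLd, mem_univ, and_true, mem_setOf_eq]
    exact Iff.rfl
  · rw [hi hz, KZ.IntegralRep.prod_integrand_eq, KZ.IntegralRep.prodFun_apply, hLi]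
    show ρ.integrand (Fin.init z) / (1 + z (Fin.last n) ^ 2) =
      ρ.integrand (Fin.init z) * (1 / (1 + z (Fin.natAdd n 0) ^ 2))
    rw [natAdd_zero_eq_last, div_eq_mul_one_div]

/-- **Disc trailing versus disc leading**: `piRep.prod ρ` relabelled along the cast
`Fin (2 + n) ≃ Fin (n + 2)` differs by relations from any record `P n ρ` with domain
`{z | z₀² + z₁² ≤ 1 ∧ (z₂, …) ∈ σ}` and integrand `f(z₂, …)` (same domain, same integrand: rule (1)).
[cite: KontsevichZagier2001, §1.2] -/
theorem reindex_equivalent_pinned (ρ : KZ.IntegralRep n) (Q : KZ.IntegralRep (n + 2))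
    (hQd : Q.domain = {z : Fin (n + 2) → ℝ | z 0 ^ 2 + z 1 ^ 2 ≤ 1 ∧
      (fun i : Fin n => z i.succ.succ) ∈ ρ.domain})
    (hQi : Q.integrand = fun z => ρ.integrand (fun i : Fin n => z i.succ.succ)) :
    KZ.Equivalent ((KZ.piRep.prod ρ).reindex (finCongr (Nat.add_comm 2 n))) Q := by
  refine KZ.of_sub_of_mem_relations_of_eqOn ?_ fun w _ => ?_
  · rw [hQd, KZ.IntegralRep.reindex_domain, KZ.IntegralRep.prod_domain]
    ext w
    simp only [mem_setOf_eq, KZ.IntegralRep.mem_prodDomain, KZ.piRep_domain, KZ.mem_piDisc,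
      finCongr_castAdd_zero, finCongr_castAdd_one, finCongr_natAdd]
  · rw [hQi, KZ.IntegralRep.reindex_integrand, KZ.IntegralRep.prod_integrand_eq]
    simp only [KZ.IntegralRep.prodFun_apply, KZ.piRep_integrand, finCongr_natAdd, one_mul]

end TubeIsTwist

open TubeIsTwist in
/-- **The tube is the twist** (item `TubeIsTwist`, stmt-KontsevichZagierPeriods-14422, route
AttractorUnfolding; stub `stub_tubeIsTwist` of line `Sketch` of crux `TateLifting`): for every operation
`P` with `(P n ρ).domain = {z | z₀² + z₁² ≤ 1 ∧ (z₂, …) ∈ σ}` and `(P n ρ).integrand z = f(z₂, …)`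
literally, and every representation `r'` with domain `{z | init z ∈ σ}` and integrand
`f(init z)/(1 + z_last²)` on it, `[r'] − [P n ρ] ∈ KZ.relations`. Chain:
`r' ∼ ρ × [ℝ, 1/(1+t²)] ∼ ρ × [disc] ∼ [disc] × ρ ∼ relabelled ∼ P n ρ`
(rule (1); `PiNormalisation` and the product ideal; commutativity of the product modulo relations;
relabelling coordinates is rule (2); rule (1)). [cite: KontsevichZagier2001, §1.2] -/
theorem tateLifting_tubeIsTwist :
    ∀ (P : ∀ n : ℕ, KZ.IntegralRep n → KZ.IntegralRep (n + 2)), (∀ (n : ℕ) (r : KZ.IntegralRep n), (P n r).domain = {z : Fin (n + 2) → ℝ | z 0 ^ 2 + z 1 ^ 2 ≤ 1 ∧ (fun i : Fin n => z i.succ.succ) ∈ r.domain} ∧ (P n r).integrand = fun z => r.integrand (fun i : Fin n => z i.succ.succ)) → ∀ (n : ℕ) (ρ : KZ.IntegralRep n) (r' : KZ.IntegralRep (n + 1)), r'.domain = {z | (Fin.init z : Fin n → ℝ) ∈ ρ.domain} → Set.EqOn r'.integrand (fun z => ρ.integrand (Fin.init z) / (1 + z (Fin.last n) ^ 2)) r'.domain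 → KZ.of r' - KZ.of (P n ρ) ∈ KZ.relations := by
  intro P hP n ρ r' hd hi
  obtain ⟨L, hLd, hLi⟩ := Summit.KontsevichZagierPeriods.CobordismMove.CP2Volume.exists_cauchyRep₁
  -- (b) the tube is the product `ρ × L`
  have h1 : KZ.Equivalent r' (ρ.prod L) := tube_equivalent_prod ρ r' hd hi L hLd hLi
  -- (a) + (c) `L ∼ disc`, and products respect equivalence
  have h2 : KZ.Equivalent (ρ.prod L) (ρ.prod KZ.piRep) :=
    (KZ.Equivalent.refl ρ).prod (cauchy_equivalent_piRep L hLd hLi)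
  -- (d) commutativity of the product modulo relations
  have h3 : KZ.Equivalent (ρ.prod KZ.piRep) (KZ.piRep.prod ρ) := by
    have h := KZ.of_mul_of_sub_of_mul_of_mem_relations ρ KZ.piRep
    rwa [KZ.of_mul_of, KZ.of_mul_of] at h
  -- (e) relabel `Fin (2 + n) ≃ Fin (n + 2)` and compare with the pinned `P n ρ`
  have h4 : KZ.Equivalent (KZ.piRep.prod ρ)
      ((KZ.piRep.prod ρ).reindex (finCongr (Nat.add_comm 2 n))) :=
    KZ.of_sub_of_reindex_mem_relations _ _
  have h5 : KZ.Equivalent ((KZ.piRep.prod ρ).reindex (finCongr (Nat.add_comm 2 n))) (P n ρ) :=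
    reindex_equivalent_pinned ρ (P n ρ) (hP n ρ).1 (hP n ρ).2
  exact ((h1.trans h2).trans (h3.trans h4)).trans h5

end Summit.KontsevichZagierPeriods.InverseLandau
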